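import Summits.Ventures.HSemireg.WedgeHankelClassSpaceSl2Triple
import Summits.Ventures.HSemireg.WedgeHankelSubstitutionSwapEigenspaces

/-!
# Venture HSemireg — THE SWAP IS THE WEYL ELEMENT OF THE `sl₂`-TRIPLE ON TH-7's CLASSES: `S·e·S = f`, `S·f·S = e`, `S·h·S = −h` (`S = SbC(0 1 1 0)`, `S² = 1`), and the
# CASIMIR IDENTITY `2(ef + fe) + h² = n(n+2)·1` — uniform in `n`, every field

HONEST FRAMING. Part of the Lean index of the computation cell `pub-hsemireg` (seat p10 gen 22, Sunday typer «UNIFORM-IN-n»).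
Finite-dimensional EXTERIOR ALGEBRA + linear algebra ONLY: no variety, no cohomology theory, no sheaf, no Ext group, no semiregularity map;
nothing here says that HC / HC_CM / HC_AV holds; no Literature fact is declared or used.  Custodian versions as in `WedgeHankelSiegelIdeal` (1/3) and `WedgeHankelFrameChange`;
the dictionary (the swap `x ↔ y` = the Weyl element of `SL₂` exchanging the root subgroups and negating the torus; the Casimir acts on `Sym^n` by `n(n+2)/2`) is QUOTED, never asserted.

WHAT IS IN THE TREE.  K27 (`WedgeHankelClassSpaceSl2Triple`): the raising / lowering / weight operators given on the spikes (`hE`, `hEtop`, `hF`, `hF0`, `hH`), `commutator_raising_lowering`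
(`ef − fe = h`), `commutator_weight_raising` / `_lowering`, `isSl2Triple_spikes`, `pow_raising_spikeBasis_of_le`; K14 (`WedgeHankelSubstitutionSwapEigenspaces`): `SbC_swap_spikeBasis`
(`S E_p = E_{n−p}`); J11 `SbC_swap_mul_swap` (`S² = 1`).  THIS FILE (namespace `Summit.Ventures.HSemireg.Wedge.HankelFrameChange` continued; imports K27, K14):
* §336 THE WEYL ELEMENT: **`swap_mul_raising_mul_swap`** (`S·e·S = f`), **`swap_mul_lowering_mul_swap`** (`S·f·S = e`), **`swap_mul_weight_mul_swap`** (`S·h·S = −h`),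
  `swap_mul_raising` (`S·e = f·S`), `swap_mul_weight` (`S·h = −h·S`).
* §337 THE CASIMIR: `raising_lowering_spikeBasis` (`e(f E_i) = i(n−i+1) E_i`), `lowering_raising_spikeBasis` (`f(e E_i) = (i+1)(n−i) E_i`), `weight_sq_spikeBasis`,
  **`casimir_spikes`: `2 • (e·f + f·e) + h·h = (n(n+2)) • 1`** (on `E_i`: `2[i(n−i+1) + (i+1)(n−i)] + (2i−n)² = n² + 2n`), `raising_lowering_eq` (`e·f = ((n(n+2)) • 1 − h·h + 2 • h)/4`-free
  form: `4 • (e·f) = (n(n+2)) • 1 − h·h + 2 • h`), `lowering_raising_eq` (`4 • (f·e) = (n(n+2)) • 1 − h·h − 2 • h`).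
NOT typed here: the lower shear as `exp(c f) = S·exp(c e)·S` (K28 + §336; next leaf), the action of the Casimir on tensor/Künneth products; anything Ext-side.  New names only.
-/

open Module

namespace Summit.Ventures.HSemireg.Wedge.HankelFrameChange

open Summit.Ventures.HSemireg.Wedge Summit.Ventures.HSemireg.Wedge.Kunneth Summit.Ventures.HSemireg.Wedge.Hankel
  Summit.Ventures.HSemireg.Wedge.BasisFree Summit.Ventures.HSemireg.Wedge.HankelSiegel Summit.Ventures.HSemireg.Wedge.HankelSiegelIdeal
  Summit.Ventures.HSemireg.Wedge.KunnethKernel Summit.Ventures.HSemireg.Wedge.HankelRankOne Summit.Ventures.HSemireg.Wedge.KernelDuality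

variable (K : Type*) [Field K] {n : ℕ}

section Weyl

variable {e f h : Module.End K (spikeSpan K n)}
  (hE : ∀ (i : Fin (n + 1)) (hi : (i : ℕ) < n), e (spikeBasis K n i) = (((i : ℕ) : K) + 1) • spikeBasis K n ⟨(i : ℕ) + 1, by omega⟩) (hEtop : e (spikeBasis K n (Fin.last n)) = 0)
  (hF : ∀ (i : Fin (n + 1)) (hi : 0 < (i : ℕ)), f (spikeBasis K n i) = ((n : K) - (i : ℕ) + 1) • spikeBasis K n ⟨(i : ℕ) - 1, by omega⟩) (hF0 : f (spikeBasis K n 0) = 0)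
  (hH : ∀ i : Fin (n + 1), h (spikeBasis K n i) = (2 * ((i : ℕ) : K) - n) • spikeBasis K n i)

/-! ## §336. The swap conjugates `e` to `f` and negates `h` -/

include hE hEtop hF hF0 in
/-- **`S·e·S = f`** (`S = SbC(0 1 1 0)`): `S e S E_i = S e E_{n−i} = (n−i+1) S E_{n−i+1} = (n−i+1) E_{i−1} = f E_i`. -/
theorem swap_mul_raising_mul_swap : SbC K 0 1 1 0 * e * SbC K 0 1 1 0 = f := by
  refine (spikeBasis K n).ext fun i => ?_
  rw [Module.End.mul_apply, Module.End.mul_apply, SbC_swap_spikeBasis]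
  by_cases hi : 0 < (i : ℕ)
  · have hr : ((Fin.rev i : Fin (n + 1)) : ℕ) < n := by rw [Fin.val_rev]; omega
    rw [hE _ hr, map_smul, SbC_swap_spikeBasis, hF i hi]
    have e1 : Fin.rev (⟨((Fin.rev i : Fin (n + 1)) : ℕ) + 1, by omega⟩ : Fin (n + 1)) = ⟨(i : ℕ) - 1, by omega⟩ :=
      Fin.ext (by rw [Fin.val_rev]; simp only [Fin.val_rev]; omega)
    rw [e1]
    congr 1
    have hv : ((Fin.rev i : Fin (n + 1)) : ℕ) = n - (i : ℕ) := by rw [Fin.val_rev]; omega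
    rw [hv, Nat.cast_sub (by omega)]
  · have ei : i = 0 := Fin.ext (by simp only [Fin.val_zero]; omega)
    rw [ei, hF0, show Fin.rev (0 : Fin (n + 1)) = Fin.last n from rfl, hEtop, map_zero]

include hE hEtop hF hF0 in
/-- **`S·f·S = e`** (conjugate the previous identity by `S`, `S² = 1`). -/
theorem swap_mul_lowering_mul_swap : SbC K 0 1 1 0 * f * SbC K 0 1 1 0 = e := by
  rw [← swap_mul_raising_mul_swap K hE hEtop hF hF0, ← mul_assoc, ← mul_assoc, SbC_swap_mul_swap, one_mul, mul_assoc, SbC_swap_mul_swap, mul_one]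

include hH in
/-- **`S·h·S = −h`**: `S h S E_i = (2(n−i) − n) E_i = −(2i − n) E_i`. -/
theorem swap_mul_weight_mul_swap : SbC K 0 1 1 0 * h * SbC K 0 1 1 0 = -h := by
  refine (spikeBasis K n).ext fun i => ?_
  rw [Module.End.mul_apply, Module.End.mul_apply, SbC_swap_spikeBasis, hH, map_smul, SbC_swap_spikeBasis, Fin.rev_rev, LinearMap.neg_apply, hH]
  have hv : ((Fin.rev i : Fin (n + 1)) : ℕ) = n - (i : ℕ) := by rw [Fin.val_rev]; omega
  rw [hv, Nat.cast_sub (Nat.le_of_lt_succ i.2)]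
  module

include hE hEtop hF hF0 in
/-- `S·e = f·S`. -/
theorem swap_mul_raising : SbC K 0 1 1 0 * e = f * SbC K 0 1 1 0 := by
  rw [← swap_mul_raising_mul_swap K hE hEtop hF hF0, mul_assoc, SbC_swap_mul_swap, mul_one]

include hH in
/-- `S·h = −h·S`. -/
theorem swap_mul_weight : SbC K 0 1 1 0 * h = -h * SbC K 0 1 1 0 := by
  rw [← swap_mul_weight_mul_swap K hH, mul_assoc, SbC_swap_mul_swap, mul_one]

/-! ## §337. The Casimir identity -/

include hE hF hF0 in
/-- `e (f E_i) = i·(n − i + 1) • E_i` (every `i`; `0` at `i = 0`). -/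
theorem raising_lowering_spikeBasis (i : Fin (n + 1)) : e (f (spikeBasis K n i)) = (((i : ℕ) : K) * ((n : K) - (i : ℕ) + 1)) • spikeBasis K n i := by
  by_cases hi : 0 < (i : ℕ)
  · rw [hF i hi, map_smul, hE ⟨(i : ℕ) - 1, by omega⟩ (by simp only; omega), smul_smul]
    have e2 : (⟨(((⟨(i : ℕ) - 1, by omega⟩ : Fin (n + 1)) : ℕ)) + 1, by simp only; omega⟩ : Fin (n + 1)) = i := Fin.ext (by simp only; omega)
    rw [e2]
    congr 1
    rw [show ((((⟨(i : ℕ) - 1, by omega⟩ : Fin (n + 1)) : ℕ) : ℕ) : K) + 1 = ((i : ℕ) : K) by simp only; rw [Nat.cast_sub (by omega), Nat.cast_one, sub_add_cancel]]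
    ring
  · rw [lowering_apply_of_not_pos K hF0 i hi, map_zero, show ((i : ℕ) : K) = 0 by rw [show (i : ℕ) = 0 by omega, Nat.cast_zero], zero_mul, zero_smul]

include hE hEtop hF in
/-- `f (e E_i) = (i + 1)·(n − i) • E_i` (every `i`; `0` at `i = n`). -/
theorem lowering_raising_spikeBasis (i : Fin (n + 1)) : f (e (spikeBasis K n i)) = ((((i : ℕ) : K) + 1) * ((n : K) - (i : ℕ))) • spikeBasis K n i := by
  by_cases hi : (i : ℕ) < n
  · rw [hE i hi, map_smul, hF ⟨(i : ℕ) + 1, by omega⟩ (by simp only; omega), smul_smul]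
    have e2 : (⟨(((⟨(i : ℕ) + 1, by omega⟩ : Fin (n + 1)) : ℕ)) - 1, by simp only; omega⟩ : Fin (n + 1)) = i := Fin.ext (by simp only; omega)
    rw [e2]
    congr 1
    simp only [Nat.cast_add, Nat.cast_one]
    ring
  · rw [raising_apply_of_not_lt K hEtop i hi, map_zero, show ((n : K) - (i : ℕ)) = 0 by rw [show (i : ℕ) = n by have := i.2; omega, sub_self], mul_zero, zero_smul]

include hH in
/-- `h (h E_i) = (2i − n)² • E_i`. -/
theorem weight_sq_spikeBasis (i : Fin (n + 1)) : h (h (spikeBasis K n i)) = ((2 * ((i : ℕ) : K) - n) * (2 * ((i : ℕ) : K) - n)) • spikeBasis K n i := by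
  rw [hH, map_smul, hH, smul_smul]

include hE hEtop hF hF0 hH in
/-- **THE CASIMIR IDENTITY `2 • (e·f + f·e) + h·h = (n(n+2)) • 1`**: on `E_i`, `2[i(n−i+1) + (i+1)(n−i)] + (2i−n)² = n² + 2n` for every `i` (every field; no `1/2` needed). -/
theorem casimir_spikes : 2 • (e * f + f * e) + h * h = ((n : K) * (n + 2)) • (1 : Module.End K (spikeSpan K n)) := by
  rw [two_nsmul]
  refine (spikeBasis K n).ext fun i => ?_
  simp only [LinearMap.add_apply, Module.End.mul_apply, LinearMap.smul_apply, Module.End.one_apply, raising_lowering_spikeBasis K hE hF hF0,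
    lowering_raising_spikeBasis K hE hEtop hF, weight_sq_spikeBasis K hH]
  module

include hE hF hF0 hH in
/-- `4 • (e·f) = (n(n+2)) • 1 − h·h + 2 • h` (the Casimir and `ef − fe = h`). -/
theorem raising_lowering_eq : 4 • (e * f) = ((n : K) * (n + 2)) • (1 : Module.End K (spikeSpan K n)) - h * h + 2 • h := by
  refine (spikeBasis K n).ext fun i => ?_
  simp only [LinearMap.add_apply, LinearMap.sub_apply, Module.End.mul_apply, LinearMap.smul_apply, Module.End.one_apply, raising_lowering_spikeBasis K hE hF hF0,
    map_smul, hH]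
  module

include hE hEtop hF hH in
/-- `4 • (f·e) = (n(n+2)) • 1 − h·h − 2 • h`. -/
theorem lowering_raising_eq : 4 • (f * e) = ((n : K) * (n + 2)) • (1 : Module.End K (spikeSpan K n)) - h * h - 2 • h := by
  refine (spikeBasis K n).ext fun i => ?_
  simp only [LinearMap.sub_apply, Module.End.mul_apply, LinearMap.smul_apply, Module.End.one_apply, lowering_raising_spikeBasis K hE hEtop hF,
    map_smul, hH]
  module

end Weyl

end Summit.Ventures.HSemireg.Wedge.HankelFrameChange
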